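import Literature.MathematicalPhysics.QuantumLattice.LTQOFrustrationFreeProofs
import HarnessLib

/-!
# Relative form bound for locally annihilated perturbations (Michalakis–Zwolak, Proposition 2)

Fourth file of the formalisation of the Michalakis–Zwolak stability theorem (hubbard.S19,
`Literature.MathematicalPhysics.QuantumLattice.michalakis_zwolak`); it proves the core of §6
("Proof of Relative Boundedness", Proposition 2) of Michalakis–Zwolak, CMP **322** (2013) 277 =
arXiv:1109.1588, in the vocabulary of `LTQO.lean`:

Let `Φ` be a projector interaction on a finite site set, `H₀ = Σ_Z Φ Z`, and let
`W = Σ_{a ∈ S} W_a` be a finite family of perturbation terms attached to regions `B_a` such that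

* `W_a` is annihilated by the local ground-state projection on both sides,
  `W_a P_{B_a} = 0 = P_{B_a} W_a` ("`W` is locally block-diagonal", MZ13 p. 13),
* the local Hamiltonians `H_{B_a}` have the local gap `g_a > 0` above their kernel
  (`HasClusterGap H_{B_a} (dim ker H_{B_a}) 0 g_a`, the Local-Gap condition),
* `‖W_a‖ ≤ κ g_a`, and every non-zero term `Φ Z` lies in at most `C` of the regions `B_a`.

Then for every vector `x`: `|⟨x, W x⟩| ≤ κ C ⟨x, H₀ x⟩` (`norm_inner_sum_le_of_locallyAnnihilated`).

This is exactly the chain of inequalities of MZ13 pp. 14–15,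
`|⟨ψ, W̃_j(r_k) ψ⟩| ≤ J ŵ(r_k) ⟨ψ, G_j(r_k) ψ⟩ ≤ (J ŵ(r_k)/γ_j(r_k)) ⟨ψ, H_j(r_k) ψ⟩` and
`Σ_j H_j(r) ≤ C_d r^d H₀`, with two simplifications that the printed proof allows: (1) since
`W_a = (1 − P_a) W_a (1 − P_a)`, one has directly `|⟨x, W_a x⟩| ≤ ‖W_a‖ ‖(1 − P_a)x‖²`, and the
local gap gives `g_a ‖(1 − P_a) x‖² ≤ ⟨x, H_{B_a} x⟩` (MZ13 Corollary 1 (1),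
`re_inner_localHamiltonian_ge`), so the orthogonal unity decomposition `R^𝒴_j` and the operators
`G_j` of the printed proof (whose role is to produce `Σ_a (1 − P_a)`) are not needed; (2) the
counting `Σ_a H_{B_a} ≤ C H₀` only uses `Φ Z ≥ 0` and the multiplicity `C` of the cover, so the
`2^d`-colouring of the torus into sparse families (MZ13 p. 14, Fig. 1) is not needed for the form
bound either — it enters only through the constant (`N(r) ≤ 6^d r^d` classes there, the ball
volume `C` here, as in MZ13's final constant `c = C_d Σ_k r_k^d ŵ(r_k)/γ(r_k)`).
No definitions, no named facts (theorems only).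
-/

noncomputable section

open Matrix Finset Module
open scoped InnerProductSpace ComplexOrder Matrix.Norms.L2Operator

namespace Literature.MathematicalPhysics.QuantumLattice

section General

variable {n : Type*} [Fintype n] [DecidableEq n]

/-- `toEuclideanLin` is multiplicative: `T_{MN} x = T_M (T_N x)`. [folklore] -/
theorem toEuclideanLin_mul_apply (M N : Matrix n n ℂ) (x : EuclideanSpace ℂ n) :
    toEuclideanLin (M * N) x = toEuclideanLin M (toEuclideanLin N x) := by
  apply WithLp.ofLp_injective 2
  simp only [toLpLin_apply, WithLp.ofLp_toLp, mulVec_mulVec]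

/-- `T_{1 − P} x = x − T_P x`. [folklore] -/
theorem toEuclideanLin_one_sub_apply (P : Matrix n n ℂ) (x : EuclideanSpace ℂ n) :
    toEuclideanLin (1 - P) x = x - toEuclideanLin P x := by
  rw [map_sub, LinearMap.sub_apply, toLpLin_one, LinearMap.id_apply]

/-- The quadratic form is bounded by the operator norm: `‖⟪y, T_W y⟫‖ ≤ ‖W‖ ‖y‖²`
(Cauchy–Schwarz; `‖W‖` the L²-operator norm). [folklore] -/
theorem norm_inner_toEuclideanLin_le (W : Matrix n n ℂ) (y : EuclideanSpace ℂ n) :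
    ‖⟪y, toEuclideanLin W y⟫_ℂ‖ ≤ ‖W‖ * ‖y‖ ^ 2 :=
  calc ‖⟪y, toEuclideanLin W y⟫_ℂ‖ ≤ ‖y‖ * ‖toEuclideanLin W y‖ := norm_inner_le_norm _ _
    _ ≤ ‖y‖ * (‖toEuclideanCLM (n := n) (𝕜 := ℂ) W‖ * ‖y‖) :=
        mul_le_mul_of_nonneg_left ((toEuclideanCLM (n := n) (𝕜 := ℂ) W).le_opNorm y)
          (norm_nonneg _)
    _ = ‖W‖ * ‖y‖ ^ 2 := by rw [l2_opNorm_toEuclideanCLM]; ring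

/-- **A locally annihilated term only sees the excited component.** If `W P = 0 = P W` for a
Hermitian `P`, then `⟪x, T_W x⟫ = ⟪y, T_W y⟫` with `y = x − T_P x`, because
`W = (1 − P) W (1 − P)`. MZ13 §6 (the identity behind "`W̃_{j,a}(r_k) R^𝒴_j(r_k) = 0` for
`𝒴_a = 0`", arXiv:1109.1588 p. 14). [folklore] -/
theorem inner_toEuclideanLin_eq_of_mul_proj_eq_zero {W P : Matrix n n ℂ} (hP : P.IsHermitian)
    (hWP : W * P = 0) (hPW : P * W = 0) (x : EuclideanSpace ℂ n) :
    ⟪x, toEuclideanLin W x⟫_ℂ =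
      ⟪x - toEuclideanLin P x, toEuclideanLin W (x - toEuclideanLin P x)⟫_ℂ := by
  have hW : W = (1 - P) * W * (1 - P) := by
    rw [Matrix.sub_mul, Matrix.one_mul, hPW, sub_zero, Matrix.mul_sub, Matrix.mul_one, hWP,
      sub_zero]
  have hsym : (toEuclideanLin (1 - P)).IsSymmetric :=
    isSymmetric_toEuclideanLin_iff.mpr (Matrix.isHermitian_one.sub hP)
  conv_lhs => rw [hW]
  rw [toEuclideanLin_mul_apply, toEuclideanLin_mul_apply, ← hsym, toEuclideanLin_one_sub_apply]

/-- Hence `‖⟪x, T_W x⟫‖ ≤ ‖W‖ ‖x − T_P x‖²` for a term annihilated by the Hermitian `P` on both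
sides. MZ13 §6, p. 14 ("`‖R^𝒴 W̃_j R^𝒴‖ ≤ J ŵ(r_k) |𝒴|`" and the display following (W:bound2)).
[folklore] -/
theorem norm_inner_toEuclideanLin_le_of_mul_proj_eq_zero {W P : Matrix n n ℂ}
    (hP : P.IsHermitian) (hWP : W * P = 0) (hPW : P * W = 0) (x : EuclideanSpace ℂ n) :
    ‖⟪x, toEuclideanLin W x⟫_ℂ‖ ≤ ‖W‖ * ‖x - toEuclideanLin P x‖ ^ 2 := by
  rw [inner_toEuclideanLin_eq_of_mul_proj_eq_zero hP hWP hPW x]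
  exact norm_inner_toEuclideanLin_le W _

end General

/-! ### Counting: `Σ_a H_{B_a} ≤ C H₀` for a projector interaction -/

section Counting

variable {Λ : Type*} [Fintype Λ] [DecidableEq Λ] {q : ℕ}

/-- The quadratic form of a positive semidefinite matrix is a non-negative real:
`⟪x, T_M x⟫ = re ⟪x, T_M x⟫ ≥ 0`. [folklore] -/
theorem re_inner_toEuclideanLin_nonneg {M : Op Λ q} (hM : M.PosSemidef)
    (x : EuclideanSpace ℂ (TensorIndex Λ q)) : 0 ≤ RCLike.re ⟪x, toEuclideanLin M x⟫_ℂ := by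
  have h := hM.dotProduct_mulVec_nonneg (WithLp.ofLp x)
  rw [EuclideanSpace.inner_eq_star_dotProduct, ofLp_toLpLin, toLin'_apply,
    dotProduct_comm]
  exact (Complex.nonneg_iff.mp h).1

/-- The quadratic form of a local Hamiltonian is the sum of the forms of its terms. [folklore] -/
theorem re_inner_localHamiltonian (Φ : Interaction Λ q) (B : Finset Λ)
    (x : EuclideanSpace ℂ (TensorIndex Λ q)) :
    RCLike.re ⟪x, toEuclideanLin (localHamiltonian Φ B) x⟫_ℂ =
      ∑ Z ∈ B.powerset, RCLike.re ⟪x, toEuclideanLin (Φ Z) x⟫_ℂ := by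
  rw [localHamiltonian, map_sum, LinearMap.sum_apply, inner_sum, map_sum]

/-- **Counting lemma** (`Σ_a H_{B_a} ≤ C H₀` as quadratic forms). For a projector interaction,
if every region `Z` with `Φ Z ≠ 0` is contained in at most `C` of the regions `B_a`, `a ∈ S`,
then `Σ_{a ∈ S} re ⟪x, H_{B_a} x⟫ ≤ C · re ⟪x, H₀ x⟫`, `H₀ = Σ_Z Φ Z` (each `⟪x, Φ Z x⟫ ≥ 0`).
MZ13 §6, proof of Proposition 2, display (bnd:color): "`Σ_j H_j(r) = Σ_u (Σ_j Ind(b_u(1) ⊂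
∪_a b_{j,a}(r))) Q_u ≤ C_d r^d H₀`" (arXiv:1109.1588 p. 14). [cite: MichalakisZwolakCMP2013, §6 proof of Prop. 2 (arXiv:1109.1588 p. 14)] -/
theorem sum_re_inner_localHamiltonian_le {Φ : Interaction Λ q} (hΦ : IsProjectorInteraction Φ)
    {ι : Type*} (S : Finset ι) (B : ι → Finset Λ) {C : ℕ}
    (hC : ∀ Z, Φ Z ≠ 0 → #(S.filter fun a => Z ⊆ B a) ≤ C)
    (x : EuclideanSpace ℂ (TensorIndex Λ q)) :
    ∑ a ∈ S, RCLike.re ⟪x, toEuclideanLin (localHamiltonian Φ (B a)) x⟫_ℂ ≤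
      C * RCLike.re ⟪x, toEuclideanLin (localHamiltonian Φ univ) x⟫_ℂ := by
  set f : Finset Λ → ℝ := fun Z => RCLike.re ⟪x, toEuclideanLin (Φ Z) x⟫_ℂ with hf
  have hf0 : ∀ Z, 0 ≤ f Z := fun Z => re_inner_toEuclideanLin_nonneg (hΦ.posSemidef_apply Z) x
  simp only [re_inner_localHamiltonian, powerset_univ]
  -- exchange the sums: `Σ_a Σ_{Z ⊆ B a} f Z = Σ_Z #{a | Z ⊆ B a} f Z`
  have hswap : ∑ a ∈ S, ∑ Z ∈ (B a).powerset, f Z =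
      ∑ Z : Finset Λ, (#(S.filter fun a => Z ⊆ B a) : ℝ) * f Z := by
    have h1 : ∀ a ∈ S, ∑ Z ∈ (B a).powerset, f Z =
        ∑ Z : Finset Λ, (if Z ⊆ B a then f Z else 0) := fun a _ => by
      rw [← sum_filter]
      congr 1
      ext Z
      simp
    rw [sum_congr rfl h1, sum_comm]
    refine sum_congr rfl fun Z _ => ?_
    rw [card_eq_sum_ones, Nat.cast_sum, sum_mul, ← sum_filter]
    simp
  change ∑ a ∈ S, ∑ Z ∈ (B a).powerset, f Z ≤ C * ∑ Z : Finset Λ, f Z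
  rw [hswap, mul_sum]
  refine sum_le_sum fun Z _ => ?_
  by_cases hZ : Φ Z = 0
  · have : f Z = 0 := by simp [hf, hZ]
    rw [this, mul_zero, mul_zero]
  · exact mul_le_mul_of_nonneg_right (by exact_mod_cast hC Z hZ) (hf0 Z)

end Counting

/-! ### MZ13 Proposition 2: the relative form bound -/

section RelativeBound

variable {Λ : Type*} [Fintype Λ] [DecidableEq Λ] {q : ℕ}

/-- **Relative boundedness of a locally annihilated perturbation (Michalakis–Zwolak,
Proposition 2).** Let `Φ` be a projector interaction with `H₀ = Σ_Z Φ Z`, and `W_a`, `a ∈ S`,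
perturbation terms attached to regions `B_a` such that `W_a P_{B_a} = 0 = P_{B_a} W_a`
(`P_B = localGroundProj Φ B`), the local Hamiltonians `H_{B_a}` have the local gaps `g_a > 0`
(`HasClusterGap H_{B_a} (dim localGroundSpace Φ B_a) 0 g_a`), `‖W_a‖ ≤ κ g_a` with `0 ≤ κ`, and
every non-zero term `Φ Z` lies in at most `C` of the `B_a`. Then for every vector `x`,
`‖⟪x, (Σ_a W_a) x⟫‖ ≤ κ C re ⟪x, H₀ x⟫`.
This is Proposition 2 of MZ13 (arXiv:1109.1588 pp. 13–15: "`|⟨ψ, W ψ⟩| ≤ c · J ⟨ψ, H₀ ψ⟩`",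
`c = C_d Σ_k r_k^d ŵ(r_k)/γ(r_k)`) for one family of regions; summing the statement over radius
classes `r_k` with `κ_k = J ŵ(r_k)/γ(r_k)` and `C_k` the number of balls of radius `r_k`
containing a given term gives the printed constant. Proof: `‖⟪x, W_a x⟫‖ ≤ ‖W_a‖ ‖(1 − P_a)x‖²`
(`norm_inner_toEuclideanLin_le_of_mul_proj_eq_zero`), `g_a ‖(1 − P_a)x‖² ≤ re ⟪x, H_{B_a} x⟫`
(MZ13 Corollary 1 (1) with the local gap, `IsProjectorInteraction.re_inner_localHamiltonian_ge`),
and `Σ_a re ⟪x, H_{B_a} x⟫ ≤ C re ⟪x, H₀ x⟫` (`sum_re_inner_localHamiltonian_le`).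
[cite: MichalakisZwolakCMP2013, §6 Proposition 2 (arXiv:1109.1588 pp. 13–15)] -/
theorem norm_inner_sum_le_of_locallyAnnihilated {Φ : Interaction Λ q}
    (hΦ : IsProjectorInteraction Φ) {ι : Type*} (S : Finset ι) (B : ι → Finset Λ)
    (W : ι → Op Λ q) (g : ι → ℝ) {κ : ℝ} (hκ : 0 ≤ κ) {C : ℕ}
    (hgap : ∀ a ∈ S, (localHamiltonian Φ (B a)).HasClusterGap
      (finrank ℂ (localGroundSpace Φ (B a))) 0 (g a))
    (hWP : ∀ a ∈ S, W a * localGroundProj Φ (B a) = 0)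
    (hPW : ∀ a ∈ S, localGroundProj Φ (B a) * W a = 0)
    (hW : ∀ a ∈ S, ‖W a‖ ≤ κ * g a)
    (hC : ∀ Z, Φ Z ≠ 0 → #(S.filter fun a => Z ⊆ B a) ≤ C)
    (x : EuclideanSpace ℂ (TensorIndex Λ q)) :
    ‖⟪x, toEuclideanLin (∑ a ∈ S, W a) x⟫_ℂ‖ ≤
      κ * C * RCLike.re ⟪x, toEuclideanLin (localHamiltonian Φ univ) x⟫_ℂ := by
  calc ‖⟪x, toEuclideanLin (∑ a ∈ S, W a) x⟫_ℂ‖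
      = ‖∑ a ∈ S, ⟪x, toEuclideanLin (W a) x⟫_ℂ‖ := by
        rw [map_sum, LinearMap.sum_apply, inner_sum]
    _ ≤ ∑ a ∈ S, ‖⟪x, toEuclideanLin (W a) x⟫_ℂ‖ := norm_sum_le _ _
    _ ≤ ∑ a ∈ S, ‖W a‖ * ‖x - toEuclideanLin (localGroundProj Φ (B a)) x‖ ^ 2 :=
        sum_le_sum fun a ha => norm_inner_toEuclideanLin_le_of_mul_proj_eq_zero
          (localGroundProj_isHermitian Φ (B a)) (hWP a ha) (hPW a ha) x
    _ ≤ ∑ a ∈ S, κ * (g a * ‖x - toEuclideanLin (localGroundProj Φ (B a)) x‖ ^ 2) :=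
        sum_le_sum fun a ha => by
          rw [← mul_assoc]
          exact mul_le_mul_of_nonneg_right (hW a ha) (sq_nonneg _)
    _ ≤ ∑ a ∈ S, κ * RCLike.re ⟪x, toEuclideanLin (localHamiltonian Φ (B a)) x⟫_ℂ :=
        sum_le_sum fun a ha => mul_le_mul_of_nonneg_left
          (hΦ.re_inner_localHamiltonian_ge (hgap a ha) x) hκ
    _ = κ * ∑ a ∈ S, RCLike.re ⟪x, toEuclideanLin (localHamiltonian Φ (B a)) x⟫_ℂ := by
        rw [mul_sum]
    _ ≤ κ * (C * RCLike.re ⟪x, toEuclideanLin (localHamiltonian Φ univ) x⟫_ℂ) :=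
        mul_le_mul_of_nonneg_left (sum_re_inner_localHamiltonian_le hΦ S B hC x) hκ
    _ = κ * C * RCLike.re ⟪x, toEuclideanLin (localHamiltonian Φ univ) x⟫_ℂ := by ring

end RelativeBound

end Literature.MathematicalPhysics.QuantumLattice
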